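import Literature.AlgebraicTopology.Homotopy.SerreFibrationCellCap
import Literature.AlgebraicTopology.Homotopy.CellularSkelPush
import Literature.AlgebraicTopology.SingularHomology.FiltrationCapEndo
import Literature.AlgebraicTopology.Homotopy.SerreFibrationSkeleta
import HarnessLib

/-!
# Hard Lefschetz on the `E¹`-term of the homology spectral sequence of a Serre fibration; the edge theorem

Topic `Literature/AlgebraicTopology/Homotopy`. For a Serre fibration `p : E → X` over a Hausdorff CW
complex, the homology exact couple of the filtration `E_s = p⁻¹(Xˢ)` (`FiltrationExactCouple.lean`,
Spanier 1981, Ch. 9, Sec. 1, Ex. 5–6; `E¹_{s,q} = H_q(E_s, E_{s-1})`) carries the Lefschetz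
endomorphism `η ⌢ ·` of a class `η ∈ H²(E; K)` (`FiltrationCapEndo.lean`). This file proves that
FIBREWISE hard Lefschetz for the cap product — on every fibre `p⁻¹(x)`,
`(η| ⌢ ·)ⁱ : H_{n₀+i}(p⁻¹x; K) ≅ H_{n₀-i}(p⁻¹x; K)` for `i ≤ n₀`, and `H_k(p⁻¹x; K) = 0` for
`k > 2n₀` — implies hard Lefschetz on `E¹` centred at fibre degree `n₀`
(`EHardLefschetz`), together with the vanishing `H_q(E_s, E_{s-1}) = 0` unless
`s ≤ q ≤ s + 2n₀`: the `E¹`-term is the direct sum over the `s`-cells of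
`H_q(p⁻¹ēⱼ, p⁻¹ėⱼ) ≅ H_{q-s}(p⁻¹(Φⱼ0))` (Spanier 1981, Ch. 9, Sec. 2, Lemma 2 and Thm. 15 (a):
`CellsDirectSum.Serre.directSum_map_ιCY_bijective`, `SerreCell.exists_conj_cap`), compatibly with
the cap products. With Deligne's degeneration criterion (`ExactCoupleLefschetz.lean`; P. Deligne
1968, Thm. 1.5; C. Voisin, *Hodge Theory and Complex Algebraic Geometry II* (2003), Thm. 4.15) this
gives the **edge theorem** (Voisin II, Thm. 4.18 in homological form):

* `SerreHardLefschetz.ker_map_eq_ker_map` — a class of `H_q(p⁻¹X⁰; K)` vanishes in `H_q(E; K)`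
  iff it vanishes in `H_q(p⁻¹X¹; K)`.

Intermediate results: iterates of operators on shifted families and on direct sums
(`bijective_iterDown_shiftRight_iff`, `iterDown_lmap`), the cap-equivariant cell decomposition of
`H_•(E_s, E_{s-1})` (`toModule_lmap_relCapProduct`), hard Lefschetz and the vanishing ranges on the
pairs `(E_s, E_{s-1})` (`bijective_iterDown_pair`, `eq_zero_pair_of_lt`, `eq_zero_pair_of_gt`), and
the same for the couple (`eHardLefschetz_capEndo`). Everything is proved; no named fact.

## References

* E. H. Spanier, *Algebraic Topology*, Springer (1981), Ch. 9, Sec. 1 Ex. 5–6, Sec. 2 Lemma 2,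
  Thm. 15 (a). [Spanier1981]
* P. Deligne, *Théorème de Lefschetz et critères de dégénérescence de suites spectrales*, Publ.
  Math. IHÉS 35 (1968), Thm. 1.5, (2.4). [Deligne1968]
* C. Voisin, *Hodge Theory and Complex Algebraic Geometry II*, CUP (2003), Lemma 4.13, Thm. 4.15,
  Thm. 4.18. [VoisinHodgeII2003]
-/

noncomputable section

open Set Function Metric unitInterval CategoryTheory CategoryTheory.Limits
open scoped Topology unitInterval DirectSum
open Literature.AlgebraicTopology.SingularHomology Literature.Algebra.Homology

namespace Literature.AlgebraicTopology.Homotopy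

universe u v uK w w'

namespace SerreHardLefschetz

/-! ### Iterates on shifted families and on direct sums -/

section Graded

variable {K : Type uK} [DivisionRing K]
variable {V : ℕ → Type w} [∀ m, AddCommGroup (V m)] [∀ m, Module K (V m)]

/-- Index casts compose. [folklore] -/
theorem castLE_trans {a a' a'' : ℕ} (h : a = a') (h' : a' = a'') (x : V a) :
    castLE K V h' (castLE K V h x) = castLE K V (h.trans h') x := by
  subst h h'; rfl

/-- **Iterates of the family shifted on the right** `k ↦ V (k + a)`: if `L' k = L (k + a)` up to the
index cast, then `(L')ⁱ` at `lo` is bijective iff `Lⁱ` at `lo + a` is. [folklore] -/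
theorem bijective_iterDown_shiftRight_iff (L : ∀ m, V (m + 2) →ₗ[K] V m) (a : ℕ)
    (L' : ∀ k, V (k + 2 + a) →ₗ[K] V (k + a))
    (hL' : ∀ k (x : V (k + 2 + a)), L' k x = L (k + a) (castLE K V (by omega) x)) (i lo : ℕ) :
    Bijective (iterDown (V := fun k => V (k + a)) L' i lo) ↔ Bijective (iterDown L i (lo + a)) := by
  have key : ∀ (i lo : ℕ) (x : V (lo + 2 * i + a)),
      iterDown (V := fun k => V (k + a)) L' i lo x = iterDown L i (lo + a) (castLE K V (by omega) x) := by
    intro i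
    induction i with
    | zero => intro lo x; simp [iterDown]
    | succ i ih =>
      intro lo x
      rw [iterDown_succ, ih, iterDown_succ, hL']
      congr 1
      have h : lo + 2 * i + a = lo + a + 2 * i := by omega
      rw [← apply_castLE L h, castLE_trans]
  have hfun : (iterDown (V := fun k => V (k + a)) L' i lo : _ → _) =
      iterDown L i (lo + a) ∘ castLE K V (by omega : lo + 2 * i + a = lo + a + 2 * i) :=
    funext fun x => key i lo x
  rw [hfun]
  exact ⟨fun h => (Bijective.of_comp_iff _ (castLE_bijective _)).1 h, fun h => h.comp (castLE_bijective _)⟩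

variable {ι : Type w'} {M : ι → ℕ → Type w} [∀ j m, AddCommGroup (M j m)] [∀ j m, Module K (M j m)]

/-- **Iterates act summand-wise on direct sums**: `(⊕ⱼ Lⱼ)ⁱ = ⊕ⱼ Lⱼⁱ`. [folklore] -/
theorem iterDown_lmap (L : ∀ j m, M j (m + 2) →ₗ[K] M j m) :
    ∀ (i lo : ℕ), iterDown (V := fun m => ⨁ j, M j m) (fun m => DirectSum.lmap fun j => L j m) i lo =
      DirectSum.lmap fun j => iterDown (V := fun m => M j m) (L j) i lo
  | 0, lo => by
    apply LinearMap.ext; intro x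
    rw [iterDown_zero]
    exact (congrArg (fun f : (⨁ j, M j lo) →ₗ[K] ⨁ j, M j lo => f x) DirectSum.lmap_id).symm
  | i + 1, lo => by
    apply LinearMap.ext; intro x
    rw [iterDown_succ, iterDown_lmap L i lo, ← LinearMap.comp_apply, ← DirectSum.lmap_comp]
    rfl

/-- Summand-wise bijective iterates give a bijective iterate on the direct sum. [folklore] -/
theorem bijective_iterDown_directSum (L : ∀ j m, M j (m + 2) →ₗ[K] M j m) (i lo : ℕ)
    (h : ∀ j, Bijective (iterDown (V := fun m => M j m) (L j) i lo)) :
    Bijective (iterDown (V := fun m => ⨁ j, M j m) (fun m => DirectSum.lmap fun j => L j m) i lo) := by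
  rw [iterDown_lmap]
  exact ⟨(DirectSum.lmap_injective _).2 fun j => (h j).1, (DirectSum.lmap_surjective _).2 fun j => (h j).2⟩

end Graded

/-- An element of a zero object of `ModuleCat` is zero. [folklore] -/
theorem eq_zero_of_isZero {K : Type uK} [Ring K] {N : ModuleCat.{w} K} (h : IsZero N) (x : N) : x = 0 := by
  have h1 : (𝟙 N : N ⟶ N) = 0 := h.eq_of_src _ _
  have h2 : (𝟙 N : N ⟶ N) x = x := rfl
  rw [← h2, h1]
  rfl

/-! ### The pairs `(E_s, E_{s-1}) = (p⁻¹Xˢ, p⁻¹Xˢ⁻¹)`: cap-equivariant cell decomposition -/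

section Pair

open _root_.Topology RelCWComplex SkeletonCollar CellsDirectSum

variable (K : Type uK) [Field K]
variable {X : Type v} [TopologicalSpace X] [T2Space X] [CWComplex (univ : Set X)]
variable {E : Type u} [TopologicalSpace E] {p : E → X} (hp : IsSerreFibration p)
  (η : singularCohomology K K E 2)

/-- Index casts commute with the relative cap product. [folklore] -/
theorem castLE_relCapProduct {Y : Type u} [TopologicalSpace Y] (A : Set Y) (θ : singularCohomology K K Y 2)
    {q n n' : ℕ} (e : n = n') (h : 2 + q = n) (h' : 2 + q = n')
    (x : relativeSingularHomology K K Y A n) :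
    relCapProduct A h θ x =
      relCapProduct A h' θ (castLE K (fun m => relativeSingularHomology K K Y A m) e x) := by
  subst e
  rfl

/-- `η|_{p⁻¹ēⱼ}` is the restriction of `η|_{E_s}` along `iⱼ : p⁻¹ēⱼ → E_s`. [folklore] -/
theorem map_ιCY_restrict {s : ℕ} (j : cell (univ : Set X) s) :
    singularCohomology.map K K (ιCY p j) 2 (singularCohomology.map K K (subsetIncl (tot p s)) 2 η) =
      singularCohomology.map K K (subsetIncl (p ⁻¹' closedCell s j)) 2 η := by
  change (singularCohomology.map K K (subsetIncl (tot p s)) 2 ≫ singularCohomology.map K K (ιCY p j) 2) η = _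
  rw [← singularCohomology.map_comp]
  rfl

/-- **The cell decomposition `{iⱼ*} : ⊕ⱼ H_q(p⁻¹ēⱼ, p⁻¹ėⱼ) → H_q(E_s, E_{s-1})` is equivariant for
the cap products with `η`** (projection formula for the maps of pairs `iⱼ`).
[cite: HatcherAT2002, §3.3 p. 241; Spanier1981, Ch. 9 Sec. 2 Lemma 2] -/
theorem toModule_lmap_relCapProduct {s : ℕ} [DecidableEq (cell (univ : Set X) s)] (q : ℕ)
    (z : ⨁ j : cell (univ : Set X) s, relativeSingularHomology K K (Cl p j) (fr p j) (q + 2)) :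
    DirectSum.toModule K (cell (univ : Set X) s) (relativeSingularHomology K K ↥(tot p s) (low p s) q)
        (fun j => (relativeSingularHomology.map K K (ιCY p j) (mapsTo_ιCY_fr j) q).hom)
        (DirectSum.lmap (fun j => relCapProduct (fr p j) (show 2 + q = q + 2 by omega)
          (singularCohomology.map K K (subsetIncl (p ⁻¹' closedCell s j)) 2 η)) z) =
      relCapProduct (low p s) (show 2 + q = q + 2 by omega)
        (singularCohomology.map K K (subsetIncl (tot p s)) 2 η)
        (DirectSum.toModule K (cell (univ : Set X) s)
          (relativeSingularHomology K K ↥(tot p s) (low p s) (q + 2))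
          (fun j => (relativeSingularHomology.map K K (ιCY p j) (mapsTo_ιCY_fr j) (q + 2)).hom) z) := by
  have key :
      (DirectSum.toModule K (cell (univ : Set X) s) (relativeSingularHomology K K ↥(tot p s) (low p s) q)
          (fun j => (relativeSingularHomology.map K K (ιCY p j) (mapsTo_ιCY_fr j) q).hom)) ∘ₗ
        DirectSum.lmap (fun j => relCapProduct (fr p j) (show 2 + q = q + 2 by omega)
          (singularCohomology.map K K (subsetIncl (p ⁻¹' closedCell s j)) 2 η)) =
      (relCapProduct (low p s) (show 2 + q = q + 2 by omega)
          (singularCohomology.map K K (subsetIncl (tot p s)) 2 η)) ∘ₗ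
        DirectSum.toModule K (cell (univ : Set X) s)
          (relativeSingularHomology K K ↥(tot p s) (low p s) (q + 2))
          (fun j => (relativeSingularHomology.map K K (ιCY p j) (mapsTo_ιCY_fr j) (q + 2)).hom) := by
    refine DirectSum.linearMap_ext K fun j => LinearMap.ext fun x => ?_
    simp only [LinearMap.comp_apply, DirectSum.lmap_lof, DirectSum.toModule_lof]
    change relativeSingularHomology.map K K (ιCY p j) (mapsTo_ιCY_fr j) q _ =
      relCapProduct (low p s) _ _ (relativeSingularHomology.map K K (ιCY p j) (mapsTo_ιCY_fr j) (q + 2) x)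
    rw [← map_ιCY_restrict K η j, relativeSingularHomology.map_relCapProduct]
  exact LinearMap.congr_fun key z

variable {n₀ : ℕ}
  (hHL : ∀ (x : X) (lo i : ℕ), lo + i = n₀ → i ≤ n₀ →
    Bijective (iterDown (V := fun k => singularHomology K K ↥(p ⁻¹' {x}) k)
      (fun k => capProduct (show 2 + k = k + 2 by omega)
        (singularCohomology.map K K (subsetIncl (p ⁻¹' {x})) 2 η)) i lo))
  (hvan : ∀ (x : X) (k : ℕ), 2 * n₀ < k → ∀ c : singularHomology K K ↥(p ⁻¹' {x}) k, c = 0)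

include hp hHL in
/-- **Hard Lefschetz on `H_•(E_s, E_{s-1})`, centred at total degree `s + n₀`**, from fibrewise hard
Lefschetz: `(η| ⌢ ·)ⁱ : H_{s+n₀+i}(E_s, E_{s-1}) ≅ H_{s+n₀-i}(E_s, E_{s-1})` for `i ≤ n₀`.
[cite: Spanier1981, Ch. 9 Sec. 2 Lemma 2, Thm. 15 (a); VoisinHodgeII2003, Thm. 4.15 (proof)] -/
theorem bijective_iterDown_pair (s lo i : ℕ) (hloi : lo + i = n₀) (hi : i ≤ n₀) :
    Bijective (iterDown (V := fun q => relativeSingularHomology K K ↥(tot p s) (low p s) q)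
      (fun q => relCapProduct (low p s) (show 2 + q = q + 2 by omega)
        (singularCohomology.map K K (subsetIncl (tot p s)) 2 η)) i (lo + s)) := by
  classical
  -- summand-wise: the cells
  have hcell : ∀ j : cell (univ : Set X) s,
      Bijective (iterDown (V := fun q => relativeSingularHomology K K (Cl p j) (fr p j) q)
        (fun q => relCapProduct (fr p j) (show 2 + q = q + 2 by omega)
          (singularCohomology.map K K (subsetIncl (p ⁻¹' closedCell s j)) 2 η)) i (lo + s)) := by
    intro j
    obtain ⟨φ, hφ, hcomm⟩ := SerreCell.exists_conj_cap K j η hp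
    rw [← bijective_iterDown_shiftRight_iff
      (V := fun q => relativeSingularHomology K K (Cl p j) (fr p j) q) _ s
      (fun k => relCapProduct (fr p j) (show 2 + (k + s) = k + 2 + s by omega)
        (singularCohomology.map K K (subsetIncl (p ⁻¹' closedCell s j)) 2 η))
      (fun k x => castLE_relCapProduct K (fr p j) _ (by omega) _ _ x) i lo,
      bijective_iterDown_iff_of_conj
        (V := fun k => relativeSingularHomology K K (Cl p j) (fr p j) (k + s))
        (V' := fun k => singularHomology K K ↥(p ⁻¹' {map s j 0}) k) _ _ φ hφ hcomm i lo]
    exact hHL (map s j 0) lo i hloi hi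
  -- the direct sum, and its identification with the pair
  have hsum := bijective_iterDown_directSum
    (M := fun (j : cell (univ : Set X) s) q => relativeSingularHomology K K (Cl p j) (fr p j) q)
    (fun j q => relCapProduct (fr p j) (show 2 + q = q + 2 by omega)
      (singularCohomology.map K K (subsetIncl (p ⁻¹' closedCell s j)) 2 η)) i (lo + s) hcell
  rwa [bijective_iterDown_iff_of_conj
    (V := fun q => ⨁ j : cell (univ : Set X) s, relativeSingularHomology K K (Cl p j) (fr p j) q)
    (V' := fun q => relativeSingularHomology K K ↥(tot p s) (low p s) q) _ _
    (fun q => DirectSum.toModule K (cell (univ : Set X) s)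
      (relativeSingularHomology K K ↥(tot p s) (low p s) q)
      (fun j => (relativeSingularHomology.map K K (ιCY p j) (mapsTo_ιCY_fr j) q).hom))
    (fun q => Serre.directSum_map_ιCY_bijective K hp q)
    (fun q z => toModule_lmap_relCapProduct K η q z) i (lo + s)] at hsum

include hp in
/-- **`H_q(E_s, E_{s-1}; K) = 0` for `q < s`.** [cite: Spanier1981, Ch. 9 Sec. 2 Lemma 2, Thm. 15 (a)] -/
theorem eq_zero_pair_of_lt {s q : ℕ} (hq : q < s)
    (x : relativeSingularHomology K K ↥(tot p s) (low p s) q) : x = 0 := by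
  classical
  obtain ⟨z, rfl⟩ := (Serre.directSum_map_ιCY_bijective K hp (s := s) q).2 x
  have hz : z = 0 := by
    refine DFinsupp.ext fun j => ?_
    exact eq_zero_of_isZero (SerreCell.isZero_of_lt K j hp hq) (z j)
  rw [hz, map_zero]

include hp η hvan in
/-- **`H_q(E_s, E_{s-1}; K) = 0` for `q > s + 2n₀`** when the fibres have no homology above degree
`2n₀`. [cite: Spanier1981, Ch. 9 Sec. 2 Lemma 2, Thm. 15 (a)] -/
theorem eq_zero_pair_of_gt {s q : ℕ} (hq : s + 2 * n₀ < q)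
    (x : relativeSingularHomology K K ↥(tot p s) (low p s) q) : x = 0 := by
  classical
  obtain ⟨k, rfl⟩ : ∃ k, q = k + s := ⟨q - s, by omega⟩
  obtain ⟨z, rfl⟩ := (Serre.directSum_map_ιCY_bijective K hp (s := s) (k + s)).2 x
  have hz : z = 0 := by
    refine DFinsupp.ext fun j => ?_
    obtain ⟨φ, hφ, -⟩ := SerreCell.exists_conj_cap K j η hp
    apply (hφ k).1
    rw [hvan (map s j 0) k (by omega) (φ k (z j)), DirectSum.zero_apply, map_zero]
  rw [hz, map_zero]

end Pair

/-! ### The exact couple of `E_s = p⁻¹Xˢ` and its cap endomorphism -/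

section Couple

open _root_.Topology RelCWComplex SkeletonCollar CellsDirectSum

variable (K : Type uK) [Field K]
variable {X : Type v} [TopologicalSpace X] [T2Space X] [CWComplex (univ : Set X)]
variable {E : Type u} [TopologicalSpace E] {p : E → X} (hp : IsSerreFibration p)
  (η : singularCohomology K K E 2)

omit [TopologicalSpace E] in
/-- `E_{-1} = ∅`: the subset `low p 0` is empty. [folklore] -/
theorem isEmpty_low_zero : IsEmpty ↥(low p 0) := ⟨fun z => by
  have hz : p z.1.1 ∈ (skeletonLT (univ : Set X) ((0 : ℕ) : ℕ∞) : Set X) := z.2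
  rw [Nat.cast_zero, RelCWComplex.skeletonLT_zero_eq_base] at hz
  exact hz⟩

omit [TopologicalSpace E] in
/-- `low p (s+1) = E_s` as subsets of `E_{s+1}`. [folklore] -/
theorem low_succ_eq (s : ℕ) : low p (s + 1) = Subtype.val ⁻¹' tot p s := by
  ext z
  change p z.1 ∈ (skeletonLT (univ : Set X) ((s + 1 : ℕ) : ℕ∞) : Set X) ↔
    p z.1 ∈ (skeletonLT (univ : Set X) ((s : ℕ∞) + 1) : Set X)
  rw [Nat.cast_succ]

variable {n₀ : ℕ}
  (hHL : ∀ (x : X) (lo i : ℕ), lo + i = n₀ → i ≤ n₀ →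
    Bijective (iterDown (V := fun k => singularHomology K K ↥(p ⁻¹' {x}) k)
      (fun k => capProduct (show 2 + k = k + 2 by omega)
        (singularCohomology.map K K (subsetIncl (p ⁻¹' {x})) 2 η)) i lo))
  (hvan : ∀ (x : X) (k : ℕ), 2 * n₀ < k → ∀ c : singularHomology K K ↥(p ⁻¹' {x}) k, c = 0)

include hp hHL in
/-- Hard Lefschetz on the pair `(E_{s+1}, L)` for any subset `L` equal to `low p (s+1)` (transport
along the equality `low p (s+1) = E_s`). [folklore] -/
theorem bijective_iterDown_pair_of_eq {s : ℕ} {L : Set ↥(tot p (s + 1))} (hL : low p (s + 1) = L)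
    (lo i : ℕ) (hloi : lo + i = n₀) (hi : i ≤ n₀) :
    Bijective (iterDown (V := fun q => relativeSingularHomology K K ↥(tot p (s + 1)) L q)
      (fun q => relCapProduct L (show 2 + q = q + 2 by omega)
        (singularCohomology.map K K (subsetIncl (tot p (s + 1))) 2 η)) i (lo + (s + 1))) := by
  subst hL
  exact bijective_iterDown_pair K hp η hHL (s + 1) lo i hloi hi

include hp in
/-- Vanishing below the diagonal for any subset equal to `low p (s+1)`. [folklore] -/
theorem eq_zero_pair_of_lt_of_eq {s q : ℕ} {L : Set ↥(tot p (s + 1))} (hL : low p (s + 1) = L)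
    (hq : q < s + 1) (x : relativeSingularHomology K K ↥(tot p (s + 1)) L q) : x = 0 := by
  subst hL
  exact eq_zero_pair_of_lt K hp hq x

include hp η hvan in
/-- Vanishing above the window for any subset equal to `low p (s+1)`. [folklore] -/
theorem eq_zero_pair_of_gt_of_eq {s q : ℕ} {L : Set ↥(tot p (s + 1))} (hL : low p (s + 1) = L)
    (hq : s + 1 + 2 * n₀ < q) (x : relativeSingularHomology K K ↥(tot p (s + 1)) L q) : x = 0 := by
  subst hL
  exact eq_zero_pair_of_gt K hp η hvan hq x

include hHL in
/-- **Hard Lefschetz on `E¹` for the cap endomorphism of the couple of `E_s = p⁻¹Xˢ`.**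
[cite: VoisinHodgeII2003, Thm. 4.15 (proof); Spanier1981, Ch. 9 Sec. 2 Thm. 15 (a)] -/
theorem eHardLefschetz_capEndo :
    (Filtration.capEndo K (tot p) (SerreSkeleta.monotone_tot p) η (SerreSkeleta.exists_subset_tot hp.continuous)).EHardLefschetz n₀ := by
  intro s loT i hloi hi
  obtain ⟨lo, rfl⟩ : ∃ lo, loT = lo + s := ⟨loT - s, by omega⟩
  cases s with
  | zero =>
    -- `E₀ = H_•(p⁻¹X⁰)`: compare with the pair `(p⁻¹X⁰, ∅)` through `j_*`
    haveI := isEmpty_low_zero (p := p)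
    haveI := fun q => relativeSingularHomology.isIso_ofAbsolute_of_isEmpty K K (X := ↥(tot p 0)) (low p 0) q
    have h := bijective_iterDown_pair K hp η hHL 0 lo i (by omega) hi
    rw [← bijective_iterDown_iff_of_conj
      (V := fun q => singularHomology K K ↥(tot p 0) q)
      (V' := fun q => relativeSingularHomology K K ↥(tot p 0) (low p 0) q)
      (fun q => capProduct (show 2 + q = q + 2 by omega)
        (singularCohomology.map K K (subsetIncl (tot p 0)) 2 η)) _
      (fun q => (relativeSingularHomology.ofAbsolute K K ↥(tot p 0) (low p 0) q).hom)
      (fun q => SerreCube.bijective_of_isIso' K _)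
      (fun q x => (relCapProduct_ofAbsolute (low p 0) _ _ x).symm) i (lo + 0)] at h
    exact h
  | succ s =>
    exact bijective_iterDown_pair_of_eq K hp η hHL (low_succ_eq s) lo i (by omega) hi

include hp in
/-- Vanishing of `E_{s,q}` for `q < s`. [cite: Spanier1981, Ch. 9 Sec. 2 Thm. 15 (a)] -/
theorem capEndo_lo (s q : ℕ) (hq : q < s) (x : Filtration.E K (tot p) s q) : x = 0 := by
  cases s with
  | zero => exact absurd hq (Nat.not_lt_zero q)
  | succ s => exact eq_zero_pair_of_lt_of_eq K hp (low_succ_eq s) hq x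

include hp η hvan in
/-- Vanishing of `E_{s,q}` for `q > s + 2n₀`. [cite: Spanier1981, Ch. 9 Sec. 2 Thm. 15 (a)] -/
theorem capEndo_hi (s q : ℕ) (hq : s + 2 * n₀ < q) (x : Filtration.E K (tot p) s q) : x = 0 := by
  cases s with
  | zero =>
    haveI := isEmpty_low_zero (p := p)
    haveI := relativeSingularHomology.isIso_ofAbsolute_of_isEmpty K K (X := ↥(tot p 0)) (low p 0) q
    have h0 : relativeSingularHomology.ofAbsolute K K ↥(tot p 0) (low p 0) q x = 0 :=
      eq_zero_pair_of_gt K hp η hvan (by omega) _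
    exact (SerreCube.bijective_of_isIso' K
      (relativeSingularHomology.ofAbsolute K K ↥(tot p 0) (low p 0) q)).1 (h0.trans (map_zero _).symm)
  | succ s => exact eq_zero_pair_of_gt_of_eq K hp η hvan (low_succ_eq s) hq x

include hp η hHL hvan in
/-- **The edge theorem of the Leray–Serre spectral sequence under fibrewise hard Lefschetz**
(Deligne 1968; Voisin II, Thm. 4.15 with Thm. 4.18, homological form): for a Serre fibration
`p : E → X` over a Hausdorff CW complex and `η ∈ H²(E; K)` whose restrictions to the fibres
satisfy hard Lefschetz for the cap product (centred at `n₀`, with `H_k(p⁻¹x) = 0` for `k > 2n₀`),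
a class of `H_q(p⁻¹X⁰; K)` vanishes in `H_q(E; K)` iff it already vanishes in `H_q(p⁻¹X¹; K)`.
[cite: VoisinHodgeII2003, Thm. 4.15 and Thm. 4.18; Deligne1968, Thm. 1.5] -/
theorem ker_map_eq_ker_map (q : ℕ) :
    LinearMap.ker (singularHomology.map K K (subsetIncl (tot p 0)) q).hom =
      LinearMap.ker (singularHomology.map K K
        (subsetInclusion (SerreSkeleta.monotone_tot p (Nat.le_add_right 0 1)) :
          C(↥(tot p 0), ↥(tot p (0 + 1)))) q).hom :=
  Filtration.ker_map_eq_ker_map_of_eHardLefschetz K (tot p) (SerreSkeleta.monotone_tot p) η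
    (SerreSkeleta.exists_subset_tot hp.continuous) (eHardLefschetz_capEndo K hp η hHL) (capEndo_lo K hp)
    (capEndo_hi K hp η hvan) q

end Couple

end SerreHardLefschetz

end Literature.AlgebraicTopology.Homotopy
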